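import Summits.QuantumFields.BalabanUV.T4Continuum.Support.NE7K1LinSchurLineDerivU1
import Summits.QuantumFields.BalabanUV.T4Continuum.Support.NE7K1LinSchurLineU1Sharp

/-!
# NE7K1LinSchurLineDerivU1Decay — row NE7 (node U5), candidate route HOM, path H1L, cell K1-lin(s): the η-UNIFORM `∂_s`
# LETTER AT U = 1 WITH DECAY — entrywise, `|(G(s) − G(t))(x,y)| ≤ min(C₁|t−s|, (4∕γ₀)e^{−δ·dist(x,y)})
# ≤ (C₁·(4∕γ₀))^{1∕2}·|t−s|^{1∕2}·e^{−δ·dist(x,y)∕2}`: HÖLDER-½ in `s` AND exponentially decaying, every constant mesh-free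

Lineage `b2b-balaban-t4-ne7-p2` (CRUX PROVER NE7 #2), generation 64; corollary of `NE7K1LinSchurLineDerivU1.twoCutoff_inv_lipschitz`
(operator-norm Lipschitz in `s`, mesh-free, `C₁ = L²∕(c₁²γ₀)`) and `NE7K1LinSchurLineU1Sharp.twoCutoff_inv_decay_sharp` (entrywise
decay `(2∕γ₀)e^{−δ·dist}` for every `s`, mesh-free).  WHY: the cell wants the `∂_s` kernel WITH DECAY and UNIFORM in the mesh;
the weighted-`ℓ²` route (`NE7K1LinSchurLineDeriv`) has decay but mesh-dependent constants, the form-relative route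
(`NE7K1LinSchurLineDerivU1`) is mesh-free but unweighted.  The two mesh-free statements interpolate entrywise (`min(a,b) ≤ √(ab)`):
half the decay rate, Hölder exponent ½ — a genuine (if not optimal) mesh-free continuity-with-decay modulus of the two-cutoff
propagator in `s`.  [folklore]; no `sorry`.

* `entry_sq_le_of_form_bound` — `|Mxy|² ≤ C` whenever the `‖Mg‖² ≤ C‖g‖²`-type bound holds at `g = δ_y`;
* **`twoCutoff_inv_sub_entry_le_min`** and **`twoCutoff_inv_sub_entry_le_sqrt`** (displayed above; `γ₀ = min(2,a)`,
  `c₁ = ((6(d+1)L²+6)L^{d+1}∕(2L²))⁻¹`, window `L^{d+1}(2(d+1)δ²L² + a(e^δ−1)) ≤ γ₀∕2` of `…U1Sharp`).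

HONEST FRAMING: Gaussian `A = 0` only; crude constants; Hölder-½ (not Lipschitz) once decay is asked mesh-free by this route;
nothing printed asserted.  FIXED FINITE T⁴, rung (B)+1; NE7 NOT PRINTED ∕ NOT PROVED; spine 0∕9; NOT infinite volume, NOT mass gap,
NOT Clay.  HONEST DEPENDENCY: continuum YM on T⁴ ⇐ BetaPertH ∧ nine spine estimates (0/9 proved); BetaPertH ⇐ (D1) ∧ (D4) ∧
CAP+tail; G-an2-4 gates asym, D1 and NE2/3/4.
-/

noncomputable section

open Finset Matrix

namespace Summit.QuantumFields.BalabanUV.T4Continuum.NE7K1LinSchurLineDerivU1Decay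

open Literature.MathematicalPhysics.QuantumFieldTheory.Balaban1983to89
open Literature.MathematicalPhysics.QuantumFieldTheory.Balaban1983to89.B4Reflection242
open Literature.MathematicalPhysics.QuantumFieldTheory.Balaban1983to89.B4Lower18
open NE7K1LinSchurLineForm NE7K1LinBlockCoords NE7K1LinSchurLineU1 NE7K1LinSchurLineU1Sharp NE7K1LinSchurLineDerivU1

/-- an entry is bounded by the quadratic-form bound tested on a basis vector: if `‖Mδ_y‖² ≤ C·‖δ_y‖²` then `(M x y)² ≤ C`.
[folklore] -/
theorem entry_sq_le_of_form_bound {ι : Type*} [Fintype ι] [DecidableEq ι] (M : Matrix ι ι ℝ) {C : ℝ} (x y : ι)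
    (h : M.mulVec (Pi.single y 1) ⬝ᵥ M.mulVec (Pi.single y 1) ≤ C * (Pi.single y (1 : ℝ) ⬝ᵥ Pi.single y 1)) :
    (M x y) ^ 2 ≤ C := by
  have hδ : (Pi.single y (1 : ℝ) : ι → ℝ) ⬝ᵥ Pi.single y 1 = 1 := by
    simp
  rw [hδ, mul_one, mulVec_single_one] at h
  have hx : (M x y) ^ 2 ≤ M.col y ⬝ᵥ M.col y := by
    have : M.col y ⬝ᵥ M.col y = ∑ i, (M i y) ^ 2 := by simp only [dotProduct, Matrix.col_apply, sq]
    rw [this]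
    exact Finset.single_le_sum (f := fun i => (M i y) ^ 2) (fun _ _ => sq_nonneg _) (Finset.mem_univ x)
  exact hx.trans h

variable {d n L : ℕ} [NeZero L] {R' : Finset (Fin (d + 1) → ℤ)}

/-- **ENTRYWISE: LIPSCHITZ-IN-`s` AND DECAY, BOTH MESH-FREE**: `|(G(s) − G(t))(x,y)| ≤ min(C₁|t−s|, (4∕γ₀)e^{−δ·dist(x,y)})`,
`C₁ = L²∕(c₁·(c₁·γ₀))`. [folklore] -/
theorem twoCutoff_inv_sub_entry_le_min (hn : 1 ≤ n) (hR' : IsBlockUnion (n * L) R') {a δ : ℝ} (ha : 0 < a)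
    (hδ0 : 0 ≤ δ) (hδ1 : δ ≤ 1)
    (hsmall : (L : ℝ) ^ (d + 1) * (2 * ((d : ℝ) + 1) * (δ * L) ^ 2 + a * (Real.exp δ - 1)) ≤ min 2 a / 2)
    {s t : ℝ} (hs0 : 0 ≤ s) (hs1 : s ≤ 1) (ht0 : 0 ≤ t) (ht1 : t ≤ 1) (x y : ↥(R'.image (blk L))) :
    |((twoCutoffLine (isBlockUnion_fine hR') n a s)⁻¹ - (twoCutoffLine (isBlockUnion_fine hR') n a t)⁻¹) x y| ≤
      min (|t - s| * ((L : ℝ) ^ 2 / (((6 * ((d : ℝ) + 1) * (L : ℝ) ^ 2 + 6) * (L : ℝ) ^ (d + 1) / (2 * (L : ℝ) ^ 2))⁻¹ *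
        ((((6 * ((d : ℝ) + 1) * (L : ℝ) ^ 2 + 6) * (L : ℝ) ^ (d + 1) / (2 * (L : ℝ) ^ 2))⁻¹) * min 2 a))))
        (2 * (2 / min 2 a) * Real.exp (-(δ * edistR n (R'.image (blk L)) x y))) := by
  classical
  have hmin : 0 < min 2 a := lt_min (by norm_num) ha
  have hc₁pos := NE7K1LinTwoRunLower.lowerConst_pos d L
  set C₁ : ℝ := (L : ℝ) ^ 2 / (((6 * ((d : ℝ) + 1) * (L : ℝ) ^ 2 + 6) * (L : ℝ) ^ (d + 1) / (2 * (L : ℝ) ^ 2))⁻¹ *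
    ((((6 * ((d : ℝ) + 1) * (L : ℝ) ^ 2 + 6) * (L : ℝ) ^ (d + 1) / (2 * (L : ℝ) ^ 2))⁻¹) * min 2 a)) with hC₁
  have hC₁pos : 0 ≤ C₁ := by positivity
  refine le_min ?_ ?_
  · -- Lipschitz part, from the operator bound tested on `δ_y`
    have h := twoCutoff_inv_lipschitz hn hR' ha hs0 hs1 ht0 ht1 (Pi.single y 1)
    have hsq := entry_sq_le_of_form_bound _ x y h
    have h2 : ((twoCutoffLine (isBlockUnion_fine hR') n a s)⁻¹ -
        (twoCutoffLine (isBlockUnion_fine hR') n a t)⁻¹) x y ^ 2 ≤ (|t - s| * C₁) ^ 2 := by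
      rw [mul_pow, sq_abs]; exact hsq
    exact abs_le.2 (abs_le_of_sq_le_sq' h2 (by positivity))
  · -- decay part, for each of `G(s)`, `G(t)`
    have hs := (twoCutoff_inv_decay_sharp hn hR' ha hδ0 hδ1 hsmall hs0 hs1 x y).2
    have ht := (twoCutoff_inv_decay_sharp hn hR' ha hδ0 hδ1 hsmall ht0 ht1 x y).2
    rw [Matrix.sub_apply]
    calc |(twoCutoffLine (isBlockUnion_fine hR') n a s)⁻¹ x y - (twoCutoffLine (isBlockUnion_fine hR') n a t)⁻¹ x y|
        ≤ |(twoCutoffLine (isBlockUnion_fine hR') n a s)⁻¹ x y| + |(twoCutoffLine (isBlockUnion_fine hR') n a t)⁻¹ x y| :=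
          abs_sub _ _
      _ ≤ _ := by linarith

/-- **HÖLDER-½ IN `s` WITH HALF THE DECAY RATE, MESH-FREE**:
`|(G(s) − G(t))(x,y)| ≤ √(C₁·(4∕γ₀))·√|t−s|·e^{−δ·dist(x,y)∕2}`. [folklore] -/
theorem twoCutoff_inv_sub_entry_le_sqrt (hn : 1 ≤ n) (hR' : IsBlockUnion (n * L) R') {a δ : ℝ} (ha : 0 < a)
    (hδ0 : 0 ≤ δ) (hδ1 : δ ≤ 1)
    (hsmall : (L : ℝ) ^ (d + 1) * (2 * ((d : ℝ) + 1) * (δ * L) ^ 2 + a * (Real.exp δ - 1)) ≤ min 2 a / 2)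
    {s t : ℝ} (hs0 : 0 ≤ s) (hs1 : s ≤ 1) (ht0 : 0 ≤ t) (ht1 : t ≤ 1) (x y : ↥(R'.image (blk L))) :
    |((twoCutoffLine (isBlockUnion_fine hR') n a s)⁻¹ - (twoCutoffLine (isBlockUnion_fine hR') n a t)⁻¹) x y| ≤
      Real.sqrt (((L : ℝ) ^ 2 / (((6 * ((d : ℝ) + 1) * (L : ℝ) ^ 2 + 6) * (L : ℝ) ^ (d + 1) / (2 * (L : ℝ) ^ 2))⁻¹ *
        ((((6 * ((d : ℝ) + 1) * (L : ℝ) ^ 2 + 6) * (L : ℝ) ^ (d + 1) / (2 * (L : ℝ) ^ 2))⁻¹) * min 2 a))) * (2 * (2 / min 2 a))) *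
        Real.sqrt |t - s| * Real.exp (-(δ * edistR n (R'.image (blk L)) x y) / 2) := by
  have hmin : 0 < min 2 a := lt_min (by norm_num) ha
  have hc₁pos := NE7K1LinTwoRunLower.lowerConst_pos d L
  set C₁ : ℝ := (L : ℝ) ^ 2 / (((6 * ((d : ℝ) + 1) * (L : ℝ) ^ 2 + 6) * (L : ℝ) ^ (d + 1) / (2 * (L : ℝ) ^ 2))⁻¹ *
    ((((6 * ((d : ℝ) + 1) * (L : ℝ) ^ 2 + 6) * (L : ℝ) ^ (d + 1) / (2 * (L : ℝ) ^ 2))⁻¹) * min 2 a)) with hC₁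
  have hC₁pos : 0 ≤ C₁ := by positivity
  set E := Real.exp (-(δ * edistR n (R'.image (blk L)) x y)) with hE
  have hEpos : 0 < E := Real.exp_pos _
  have h := twoCutoff_inv_sub_entry_le_min hn hR' ha hδ0 hδ1 hsmall hs0 hs1 ht0 ht1 x y
  -- `min(a,b) ≤ √(ab)` for `a, b ≥ 0` (inline; the tree has it under `Literature.Analysis.FluidPDE`)
  have hmin_sqrt : ∀ a b : ℝ, 0 ≤ a → 0 ≤ b → min a b ≤ Real.sqrt (a * b) := by
    intro a b ha hb
    have hsq : (min a b) ^ 2 ≤ a * b := by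
      rw [sq]
      rcases le_total a b with h | h
      · rw [min_eq_left h]; exact mul_le_mul_of_nonneg_left h ha
      · rw [min_eq_right h]; exact mul_le_mul_of_nonneg_right h hb
    calc min a b = Real.sqrt ((min a b) ^ 2) := (Real.sqrt_sq (le_min ha hb)).symm
      _ ≤ Real.sqrt (a * b) := Real.sqrt_le_sqrt hsq
  refine h.trans ((hmin_sqrt _ _ (by positivity) (by positivity)).trans (le_of_eq ?_))
  have hsplit : |t - s| * C₁ * (2 * (2 / min 2 a) * E) = (C₁ * (2 * (2 / min 2 a))) * |t - s| * E := by ring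
  rw [hsplit, Real.sqrt_mul (by positivity), Real.sqrt_mul (by positivity)]
  congr 1
  rw [hE, ← Real.exp_half, neg_div]

end Summit.QuantumFields.BalabanUV.T4Continuum.NE7K1LinSchurLineDerivU1Decay
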